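import Summits.Ventures.WeilGRH.DualTrigKernelLattice
import Summits.Ventures.WeilGRH.DualTrigKernelWindow
import HarnessLib

/-!
# Format D-K v3 (multi-lattice): a certificate on a GENERAL window `[−t, t]`, `t = tn/td`

Cell `rh-explicit`, WEIL TRACK — GRH ARM, route B (weil-grh-3, gen18).  The v3 door
(`DualTrigKernelLattice*.lean`) ties the admissibility of every atom to the STANDARD rung
`t = log (N+1) / 2`: `atomsOK` demands `(N+1)^D ≤ p₀^k` for the base atoms and `latsOK` demands
`(N+1)^{D_p} ≤ p^k` for the atoms of lattice `p`, i.e. every frequency `≥ log (N+1)`.  For a window that is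
NOT of that form — above all `t = 1` itself (`N = 7`, `e² ≤ 8`), where the admissible spectrum starts at
`2 < log 8 = 2.079…` — the multiplier may use every atom with frequency `≥ 2t`.  The dual LP shows that
this is exactly what the small-conductor classes need: the extremal dual measure carries mass AT the
spectral edge `2t`, and at `t = 1` the two extra atoms near `2` (`35·log 2/12`, `5·log 5/4`, or a
one-atom «edge lattice» such as `log 2981 / 4 = 2.0000025`) double the margin of the thin odd classes of
conductor `13` and `11` (seat record HOME/weil-grh-3/gen18/README.md).  As gen15's `DualTrigKernelWindow.lean`
did for format v1, this file records the v3 soundness statements on a general window; the pointwise part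
(`P3_nonneg_of_checkL`) never used the admissibility clauses, so nothing new is computed per cell:

* `DKCert3.latsOKw tn td` — the lattice frame check with the RUNG admissibility replaced by the integer
  WINDOW admissibility `2·tn·D_p·S ≤ k·lo(log p)·td` (`lo(log p)` = the lower end of the engine's
  `MI.logNat` enclosure, so the test is decidable); `latsOKw_sound`;
* `DKCert3.P3_nonneg_of_partsW` — `P(θ) ≥ 0` on `ℝ` from `constsOK`, `valsOK`, `blocksOK`, `latsOKw`,
  `latCoverOK`, `tailOK3` and the cell bounds `CellBounds` (the body of `P3_nonneg_of_partsCB` verbatim);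
* `DKCert3.sound_familyL_of_partsW` — the multiplier inequality for the key group at every modulus `q ≥ c.base.q`;
* `DKCert3.allAtomsT_window` — every atom (base: `DKCert.atomT_freq_ge_of_windowOK`; lattices: from
  `latsOKw`) has frequency `≥ 2·tn/td`;
* `DKCert3.weilPositivityOnChar_window_family_of_partsW` — the rung `WeilPositivityOnChar χ (tn/td)` for
  the key group at every modulus `q ≥ c.base.q`, given `e^{2tn/td} ≤ N + 1`
  (`weilPositivityOnChar_of_trigDual_window`).

An instance file evaluates the Boolean facts by `decide` (the cells by `decide +kernel`) and discharges
`e^{2 tn/td} ≤ N + 1` by an elementary bound (`t = 1`: `Real.exp_one_lt_d9`).  Everything here is PROVED;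
no named facts, no `sorry`, no kernel evaluation.

## References

* A. Weil, *Sur les "formules explicites" de la théorie des nombres premiers* (1952), (11) and the
  «lemme» p. 262 (the hermitian functional on a window).
* H. Yoshida, *On Hermitian forms attached to zeta functions* (1992), §0 (the spaces `C(a)`). [folklore consequences]
-/

noncomputable section

open Finset Real Complex

namespace Summit.Ventures.WeilGRH

open Literature.Analysis.ValidatedNumerics.NumericsMP
open Literature.NumberTheory.LFunctions
open DualTrigTaylor DigammaVertical

namespace DKCert3

variable {c : DKCert3}

/-! ### The window lattice check -/

/-- The lattice frame check for the WINDOW `t = tn/td`: `latsOK` with the rung admissibility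
`(N+1)^{D_p} ≤ p^k` replaced by the integer window admissibility `2·tn·D_p·S ≤ k·lo(log p)·td`
(every atom of lattice `p` has frequency `k log p / D_p ≥ 2 tn/td`). [folklore] -/
def latsOKw (c : DKCert3) (tn td : ℕ) : Bool :=
  decide ((c.lats.map (·.p)).Nodup) && c.restTerms.isSome &&
  c.lats.all fun l =>
    decide (2 ≤ l.p) && decide (l.p ≠ c.base.p0) && decide (1 ≤ l.D) && decide (0 < l.rI.lo) &&
    (match MI.logNat c.base.S c.base.Kser l.p with
      | some Lp =>
        match MI.divPos c.base.S (Lp.mulInt c.base.D) (c.base.logp0I.mulInt l.D) with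
        | some R => DKCert.encl l.rI R
        | none => false
      | none => false) &&
    (match MI.logNat c.base.S c.base.Kser l.p with
      | some Lp => l.atoms.all fun atm => decide ((2 * tn * l.D * c.base.S : ℤ) ≤ (atm.k : ℤ) * Lp.lo * td)
      | none => false) &&
    (!c.base.even || l.atoms.all fun atm => atm.b == 0) &&
    (c.latWinTerms l).isSome

/-- Unpacking `latsOKw`: as `latsOK_sound`, with the window admissibility `2·tn·D_p ≤ k·log p·td` (reals)
in place of the rung admissibility. [folklore] -/
theorem latsOKw_sound {tn td : ℕ} (h : c.latsOKw tn td = true) (hS : 0 < c.base.S)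
    (hlog : MI.mem c.base.S (Real.log c.base.p0) c.base.logp0I) :
    (c.lats.map (·.p)).Nodup ∧ c.restTerms.isSome = true ∧ ∀ l ∈ c.lats,
      2 ≤ l.p ∧ l.p ≠ c.base.p0 ∧ 1 ≤ l.D ∧ 0 < l.rI.lo ∧ MI.mem c.base.S (c.ratR l) l.rI ∧
      (∀ atm ∈ l.atoms, (2 * tn * l.D : ℝ) ≤ atm.k * Real.log l.p * td) ∧
      (c.base.even = true → ∀ atm ∈ l.atoms, atm.b = 0) ∧ (c.latWinTerms l).isSome = true := by
  unfold latsOKw at h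
  simp only [Bool.and_eq_true, decide_eq_true_eq, List.all_eq_true] at h
  obtain ⟨⟨hnd, hrest⟩, hall⟩ := h
  refine ⟨hnd, hrest, fun l hl ↦ ?_⟩
  obtain ⟨⟨⟨⟨⟨⟨⟨hp, hne⟩, hD⟩, hlo⟩, hrat⟩, hadm⟩, heven⟩, hwin⟩ := hall l hl
  have hSr : (0 : ℝ) < c.base.S := by exact_mod_cast hS
  refine ⟨hp, hne, hD, hlo, ?_, fun atm hatm ↦ ?_, fun he atm hatm ↦ ?_, hwin⟩
  · cases hL : MI.logNat c.base.S c.base.Kser l.p with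
    | none => simp [hL] at hrat
    | some Lp =>
      simp only [hL] at hrat
      cases hR : MI.divPos c.base.S (Lp.mulInt c.base.D) (c.base.logp0I.mulInt l.D) with
      | none => simp [hR] at hrat
      | some R =>
        simp only [hR] at hrat
        have hm := MI.mem_divPos hS hR (MI.mem_mulInt (MI.mem_logNat hS hL) c.base.D) (MI.mem_mulInt hlog l.D)
        refine DKCert.mem_of_encl hrat ?_
        have e : c.ratR l = Real.log l.p * (c.base.D : ℤ) / (Real.log c.base.p0 * (l.D : ℤ)) := by
          unfold ratR; push_cast; ring
        rw [e]; exact hm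
  · cases hL : MI.logNat c.base.S c.base.Kser l.p with
    | none => simp [hL] at hadm
    | some Lp =>
      simp only [hL, List.all_eq_true, decide_eq_true_eq] at hadm
      have h1 := hadm atm hatm
      have hmem := MI.mem_logNat hS hL
      have hlo' : (Lp.lo : ℝ) ≤ Real.log l.p * c.base.S := hmem.1
      have hr : ((2 * tn * l.D * c.base.S : ℤ) : ℝ) ≤ ((atm.k * Lp.lo * td : ℤ) : ℝ) := by exact_mod_cast h1
      push_cast at hr
      have hk0 : (0 : ℝ) ≤ atm.k := Nat.cast_nonneg _
      have htd0 : (0 : ℝ) ≤ td := Nat.cast_nonneg _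
      have hkt : (atm.k : ℝ) * (Lp.lo : ℝ) * td ≤ atm.k * (Real.log l.p * c.base.S) * td :=
        mul_le_mul_of_nonneg_right (mul_le_mul_of_nonneg_left hlo' hk0) htd0
      have hmain : (2 * tn * l.D : ℝ) * c.base.S ≤ (atm.k * Real.log l.p * td) * c.base.S := by nlinarith
      exact le_of_mul_le_mul_right hmain hSr
  · simp only [he, Bool.not_true, Bool.false_or, List.all_eq_true, beq_iff_eq] at heven
    exact heven atm hatm

/-! ### The certificate function is nonnegative (window parts) -/

/-- **The certificate function is `≥ 0` everywhere, from the frame PARTS with the window lattice check `latsOKw`**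
(the body of `P3_nonneg_of_checkL` verbatim: it never used the rung admissibility of the atoms). [folklore] -/
theorem P3_nonneg_of_partsW (hconsts : c.base.constsOK = true) (hvals : c.base.valsOK = true)
    (hblocks : c.base.blocksOK = true) {tn td : ℕ}
    (hlats : c.latsOKw tn td = true) (hcover : c.latCoverOK = true) (htail : c.tailOK3 = true)
    (hcb : CellBounds c) (θ : ℝ) : 0 ≤ c.P3 θ := by
  obtain ⟨hS, hp0, hD, _, hR, _, hpi, hlog, hrho, hC⟩ := DKCert.constsOK_sound hconsts
  obtain ⟨hρ, hρω⟩ := DKCert.rhoR_pos_and_mul hp0 hD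
  obtain ⟨hnd, hrest, hlat⟩ := latsOKw_sound hlats hS hlog
  have hratm : ∀ l ∈ c.lats, MI.mem c.base.S (c.ratR l) l.rI := fun l hl ↦ (hlat l hl).2.2.2.2.1
  have hF := terms3_repr hS hpi hlog hp0 hvals hratm
  have hSr : (0 : ℝ) < c.base.S := by exact_mod_cast hS
  obtain ⟨hbs, hchain, b0, bl, h0, hl, hfirst, hlast⟩ := DKCert.blocksOK_sound hblocks
  obtain ⟨b0', bl', h0', hl', hcov⟩ := latCoverOK_sound hcover
  rw [h0] at h0'; rw [hl] at hl'
  obtain rfl : b0 = b0' := Option.some.inj h0'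
  obtain rfl : bl = bl' := Option.some.inj hl'
  have hb0 : b0 ∈ c.base.blocks := List.mem_of_mem_head? h0
  have hbl : bl ∈ c.base.blocks := List.mem_of_mem_getLast? hl
  have hMc0 : (0 : ℝ) < b0.Mc := by exact_mod_cast (hbs b0 hb0).1
  have hMcl : (0 : ℝ) < bl.Mc := by exact_mod_cast (hbs bl hbl).1
  have hend : π ≤ DKCert.bEnd bl := by
    unfold DKCert.bEnd; rw [le_div_iff₀ hMcl]
    have : (bl.Mc : ℝ) ≤ 2 * ((bl.j0 : ℝ) + bl.n) := by exact_mod_cast hlast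
    nlinarith [Real.pi_pos]
  have hstart0 : DKCert.bStart b0 ≤ 0 := by
    unfold DKCert.bStart
    have : (b0.j0 : ℝ) ≤ 0 := by
      split_ifs at hfirst with he
      · exact_mod_cast hfirst
      · have : (2 * b0.j0 : ℝ) ≤ -(b0.Mc : ℝ) := by exact_mod_cast hfirst
        linarith
    have : 2 * π * (b0.j0 : ℝ) ≤ 0 := by nlinarith [Real.pi_pos]
    exact div_nonpos_of_nonpos_of_nonneg this hMc0.le
  have hstartπ : c.base.even = false → DKCert.bStart b0 ≤ -π := by
    intro he; simp only [he] at hfirst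
    unfold DKCert.bStart; rw [div_le_iff₀ hMc0]
    have : (2 * b0.j0 : ℝ) ≤ -(b0.Mc : ℝ) := by exact_mod_cast hfirst
    nlinarith [Real.pi_pos]
  -- evenness data
  have hevenB : c.base.even = true → ∀ t ∈ c.terms3R, t.B = 0 := by
    intro he t ht
    unfold terms3R at ht
    rw [List.mem_append] at ht
    rcases ht with ht | ht
    · exact DKCert.termsR_B_zero hvals he t ht
    · exact latJoinR_B_zero c.lats (fun l hl ↦ (hlat l hl).2.2.2.2.2.2.1 he) t ht
  -- (1) the base periodic part everywhere
  have hint : ∀ rt ∈ DKCert.cList c.terms3 c.terms3R, ∃ k : ℤ, rt.κ = k := by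
    refine DKCert.cList_int c.terms3 c.terms3R hF ?_
    intro t ht hcomm
    unfold terms3 at ht
    rw [List.mem_append] at ht
    rcases ht with ht | ht
    · exact DKCert.isInt_of_comm t ht hcomm
    · rw [latJoin_comm c.lats t ht] at hcomm; exact absurd hcomm (by decide)
  have hT : ∀ θ : ℝ, (c.base.mT : ℝ) / c.base.S ≤ sumVal (DKCert.cList c.terms3 c.terms3R) θ := by
    intro θ
    obtain ⟨k, hk1, hk2⟩ := exists_reduce (2 * π) (by positivity) θ
    set θ' : ℝ := θ - k * (2 * π) with hθ'
    have hθ'1 : -π ≤ θ' := by linarith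
    have hθ'2 : θ' ≤ π := by linarith
    have hper : sumVal (DKCert.cList c.terms3 c.terms3R) θ = sumVal (DKCert.cList c.terms3 c.terms3R) θ' := by
      rw [hθ', show θ - k * (2 * π) = θ + (-k : ℤ) * (2 * π) by push_cast; ring]
      exact (DKCert.sumVal_add_int_mul _ hint θ (-k)).symm
    rw [hper]
    by_cases he : c.base.even = true
    · have hevenC : ∀ t ∈ DKCert.cList c.terms3 c.terms3R, t.B = 0 :=
        fun t ht ↦ hevenB he t (DKCert.mem_of_mem_cList _ _ t ht)
      rcases le_total 0 θ' with hpos | hneg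
      · exact baseT_ge_of_covered hblocks hcb h0 hl (hstart0.trans hpos)
          (hθ'2.trans hend) hθ'1 hθ'2
      · rw [← sumVal_neg _ hevenC θ']
        exact baseT_ge_of_covered hblocks hcb h0 hl (by linarith) (by linarith)
          (by linarith) (by linarith)
    · rw [Bool.not_eq_true] at he
      exact baseT_ge_of_covered hblocks hcb h0 hl ((hstartπ he).trans hθ'1)
        (hθ'2.trans hend) hθ'1 hθ'2
  -- (2) every lattice part everywhere
  have hL : ∀ l ∈ c.lats, ∀ θ : ℝ, (l.mT : ℝ) / c.base.S ≤ sumVal (c.latTermsR l) θ := by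
    intro l hll θ
    obtain ⟨hp, _, hDl, hlo, hr, _, hevl, _⟩ := hlat l hll
    obtain ⟨hrpos, _⟩ := ratR_pos_and_mul hp0 hD hp hDl
    set P : ℝ := 2 * π / c.ratR l with hPdef
    have hP : 0 < P := by positivity
    obtain ⟨m, hm1, hm2⟩ := exists_reduce P hP θ
    set θ' : ℝ := θ - m * P with hθ'
    have hP2 : P / 2 = π / c.ratR l := by rw [hPdef]; ring
    rw [hP2] at hm1 hm2
    have hper : sumVal (c.latTermsR l) θ = sumVal (c.latTermsR l) θ' := by
      rw [hθ', show θ - m * P = θ + (-m : ℤ) * (2 * π / c.ratR l) by rw [hPdef]; push_cast; ring]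
      exact (latT_periodic hp0 hD hvals hp hDl θ (-m)).symm
    rw [hper]
    -- the zone `|θ'| ≤ π/r` lies in the covered range
    have hlor : (0 : ℝ) < l.rI.lo := by exact_mod_cast hlo
    have hzone : π / c.ratR l ≤ π * c.base.S / l.rI.lo := by
      rw [div_le_div_iff₀ hrpos hlor]; nlinarith [Real.pi_pos, hr.1]
    obtain ⟨hcovE, hcovS⟩ := hcov l hll
    have hendl : π * c.base.S / l.rI.lo ≤ DKCert.bEnd bl := by
      unfold DKCert.bEnd
      rw [div_le_div_iff₀ hlor hMcl]
      have : ((bl.Mc : ℤ) : ℝ) * c.base.S ≤ 2 * ((bl.j0 : ℝ) + bl.n) * l.rI.lo := by exact_mod_cast hcovE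
      push_cast at this; nlinarith [Real.pi_pos]
    by_cases he : c.base.even = true
    · have hevenL := latTermsR_B_zero hvals he (hevl he) (l := l)
      rcases le_total 0 θ' with hpos | hneg
      · exact latT_ge_of_covered hblocks hcb hS h0 hl hll hr hlo (hstart0.trans hpos)
          (hm2.trans (hzone.trans hendl)) hm1 hm2
      · rw [← sumVal_neg _ hevenL θ']
        exact latT_ge_of_covered hblocks hcb hS h0 hl hll hr hlo (by linarith)
          (by linarith) (by linarith) (by linarith)
    · rw [Bool.not_eq_true] at he
      rcases hcovS with hcovS | hcovS
      · rw [he] at hcovS; exact absurd hcovS (by decide)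
      have hstartl : DKCert.bStart b0 ≤ -(π * c.base.S / l.rI.lo) := by
        unfold DKCert.bStart
        rw [← neg_div, div_le_div_iff₀ hMc0 hlor]
        have : 2 * (b0.j0 : ℝ) * l.rI.lo ≤ -((b0.Mc : ℝ) * c.base.S) := by exact_mod_cast hcovS
        nlinarith [Real.pi_pos]
      exact latT_ge_of_covered hblocks hcb hS h0 hl hll hr hlo
        (hstartl.trans ((neg_le_neg hzone).trans hm1)) (hm2.trans (hzone.trans hendl)) hm1 hm2
  -- (3) the tail
  have hLsum : ∀ θ : ℝ, ((c.mTsum : ℤ) : ℝ) / c.base.S ≤ (c.lats.map fun l ↦ sumVal (c.latTermsR l) θ).sum := by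
    intro θ
    unfold mTsum
    have : ∀ ls : List DKLat, (∀ l ∈ ls, l ∈ c.lats) →
        (((ls.map (·.mT)).sum : ℤ) : ℝ) / c.base.S ≤ (ls.map fun l ↦ sumVal (c.latTermsR l) θ).sum := by
      intro ls
      induction ls with
      | nil => simp
      | cons l ls ih =>
          intro hmem
          simp only [List.map_cons, List.sum_cons, Int.cast_add, add_div]
          exact add_le_add (hL l (hmem l (by simp)) θ) (ih fun l' hl' ↦ hmem l' (by simp [hl']))
    exact this c.lats fun l hl ↦ hl
  have hrestB : ∀ θ : ℝ, -(((c.bInc3 : ℤ) : ℝ) / c.base.S) ≤ sumVal c.restR θ := by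
    intro θ
    obtain ⟨ws, hws⟩ := Option.isSome_iff_exists.1 hrest
    have hFr := restTerms_repr hS hpi hlog hp0 hvals hws
    unfold bInc3; rw [hws, Option.getD_some]
    exact DKCert.neg_amp_le_sumVal hS ws c.restR hFr θ
  have hsplit : ∀ θ : ℝ, sumVal c.terms3R θ = sumVal (DKCert.cList c.terms3 c.terms3R) θ +
      ((c.lats.map fun l ↦ sumVal (c.latTermsR l) θ).sum + sumVal c.restR θ) := by
    intro θ
    have e1 := DKCert.sumVal_cList c.terms3 c.terms3R hF θ
    have e2 : DKCert.ncList c.terms3 c.terms3R = DKCert.ncList c.base.terms c.base.termsR ++ c.latJoinR c.lats := by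
      unfold terms3 terms3R
      exact DKCert.ncList_append_nc _ _ (DKCert.terms_repr hS hpi hlog hp0 hvals) _ _ (latJoin_repr hS c.lats hratm)
        (latJoin_comm c.lats)
    have e3 := DKCert.sumVal_ncList_base hvals θ
    have e4 := sumVal_ncVals_split hnd θ
    rw [e2, DKCert.sumVal_append, e3] at e1
    unfold ncVals at e4
    linarith [e1, e4]
  unfold tailOK3 at htail
  simp only [h0, hl, Bool.and_eq_true, Bool.or_eq_true] at htail
  obtain ⟨htl, htf⟩ := htail
  have tail_of : ∀ (Mc : ℕ) (jj : ℤ), 1 ≤ Mc →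
      (match c.base.psiTailLo Mc jj with
        | some v => decide (0 ≤ v + c.base.constI.lo - c.bInc3 + c.base.mT + c.mTsum) | none => false) = true →
      ∀ θ : ℝ, 2 * π * |(jj : ℝ)| / Mc ≤ |θ| → 0 ≤ c.P3 θ := by
    intro Mc jj hMc h θ hθ
    cases hv : c.base.psiTailLo Mc jj with
    | none => simp [hv] at h
    | some v =>
      simp only [hv, decide_eq_true_eq] at h
      have hψ := DKCert.psiTailLo_sound hS hpi hrho hρ hMc jj hv hθ
      have hCr : ((c.base.constI.lo : ℤ) : ℝ) / c.base.S ≤ c.base.constR := DKCert.lo_le hS hC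
      have hz : (0 : ℝ) ≤ ((v + c.base.constI.lo - c.bInc3 + c.base.mT + c.mTsum : ℤ) : ℝ) / c.base.S := by
        have : (0 : ℝ) ≤ ((v + c.base.constI.lo - c.bInc3 + c.base.mT + c.mTsum : ℤ) : ℝ) := by exact_mod_cast h
        positivity
      unfold P3; rw [hsplit θ]
      push_cast at hz
      have := hT θ; have := hLsum θ; have := hrestB θ
      rw [add_div, add_div, sub_div, add_div] at hz
      linarith
  -- (4) every θ: first for θ ≥ bStart b0
  have hge : ∀ θ : ℝ, DKCert.bStart b0 ≤ θ → 0 ≤ c.P3 θ := by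
    intro θ hθ
    rcases le_total θ (DKCert.bEnd bl) with hle | hgt
    · exact P3_nonneg_of_covered hblocks hcb h0 hl hθ hle
    · refine tail_of bl.Mc (bl.j0 + bl.n) (hbs bl hbl).1 htl θ ?_
      have hjj : (0 : ℝ) ≤ ((bl.j0 + bl.n : ℤ) : ℝ) := by
        have : 0 < DKCert.bEnd bl := lt_of_lt_of_le Real.pi_pos hend
        unfold DKCert.bEnd at this
        have := (div_pos_iff_of_pos_right hMcl).1 this
        push_cast; nlinarith [Real.pi_pos]
      rw [abs_of_nonneg hjj]
      have : DKCert.bEnd bl = 2 * π * ((bl.j0 + bl.n : ℤ) : ℝ) / bl.Mc := by unfold DKCert.bEnd; push_cast; ring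
      rw [← this]
      exact hgt.trans (le_abs_self θ)
  rcases le_total (DKCert.bStart b0) θ with hθ | hθ
  · exact hge θ hθ
  · by_cases he : c.base.even = true
    · -- symmetry
      have hsym : c.P3 (-θ) = c.P3 θ := by
        unfold P3
        have h1 := bracket_neg (DKCert.sigR_mem (c := c.base)).2 0 (c.base.rhoR * θ)
        simp only [bracket, Finset.range_zero, Finset.sum_empty, sub_zero] at h1
        rw [show ((c.base.rhoR * -θ : ℝ) : ℂ) = ((-(c.base.rhoR * θ) : ℝ) : ℂ) by push_cast; ring, h1,
          sumVal_neg c.terms3R (hevenB he) θ]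
      rw [← hsym]
      exact hge (-θ) (by linarith)
    · rw [Bool.not_eq_true] at he
      simp only [he, Bool.false_eq_true, false_or] at htf
      refine tail_of b0.Mc b0.j0 (hbs b0 hb0).1 htf θ ?_
      simp only [he, Bool.false_eq_true, if_false] at hfirst
      have hj0 : (b0.j0 : ℝ) ≤ 0 := by
        have : (2 * b0.j0 : ℝ) ≤ -(b0.Mc : ℝ) := by exact_mod_cast hfirst
        linarith
      rw [abs_of_nonpos hj0]
      have hθ0 : θ ≤ 0 := hθ.trans hstart0
      rw [abs_of_nonpos hθ0]
      unfold DKCert.bStart at hθ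
      have : 2 * π * -(b0.j0 : ℝ) / b0.Mc = -(2 * π * b0.j0 / b0.Mc) := by ring
      rw [this]; linarith

end DKCert3

end Summit.Ventures.WeilGRH

end
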